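import Summits.QuantumAdvantage.QuantumAdvantage.Theorems.CubicForrelationNearExactIsExactBentFourteenTwentyNineThirtySeconds
import Summits.QuantumAdvantage.QuantumAdvantage.Theorems.CubicForrelationNearExactIsExactKtGapOrder

/-!
# Crux `CubicForrelation.NearExactIsExact` (stmt-QuantumAdvantage-14043) — `n = 14`: a cubic BENT side cannot beat the record `57/64`

Certificate seat `b2b-cforr-cert` (gen 45).  HONEST FRAMING: a kernel-checked finite-slice THEOREM (standard axioms, no certificates):
for cubic `f, g : 𝔽₂¹⁴ → 𝔽₂` with `g` bent, `Φ(f,g) = 1` or `Φ(f,g) ≤ 57/64` — the record value of the `n = 14` slice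
(`Negative.ProductFourteen`, attained by a NON-bent pair).  The tree had `Φ = 1 ∨ Φ < 29/32` (`fo_bent_lt_29_32`, gen 44); the new
ingredient is the Kasami–Tokura gap `(768, 896)` of `RM(5,14)` (`kt_gap_rm5_fourteen`, from the every-order brick `kt_gap_order` of this
generation).  So inside the open window `(57/64, 61/64)` of `θ₁₄` BOTH sides are non-bent, now in Lean.  On paper the bent side is known
down to `7/8` (DISPROOF.md §18, THEOREM BENT14, machine certificates) — NOT claimed here.  NOT summit progress; `θ₁₄ ∈ [57/64, 61/64)`
is unchanged.

Proof.  `g̃ = d` has degree `≤ 5` (Hou), `Φ = 1 − 2·#{f ≠ d}/2¹⁴` (`bb_forrelation_eq_of_dual`), and `N = #{f ≠ d}` is a weight of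
`RM(5,14)`: `N = 0` (`Φ = 1`), or `N = 512` (`Φ = 15/16`, killed by `fo_bent_false`), or `N = 768` (`Φ = 29/32`, killed by
`fo_bent_ne_29_32`), or `N ≥ 896` (`rm5_fourteen_weights_below_896`), i.e. `Φ ≤ 1 − 1792/16384 = 57/64`.

References: T. Kasami, N. Tokura (1970) Thm 1; O. S. Rothaus (1976); X.-D. Hou (1998); DISPROOF.md §18.  Axioms: the standard three.
-/

set_option linter.dupNamespace false -- D-0017: single-problem summit ⇒ `QuantumAdvantage.QuantumAdvantage` by design

noncomputable section

namespace Summit.QuantumAdvantage.QuantumAdvantage.Theorems.CubicForrelation.NearExactIsExact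

open Finset
open Literature.Computability.QuantumComplexity
open Literature.Computability.QuantumComplexity.DerivativeWalsh (W)

/-- **The bent side of the `n = 14` slice cannot beat the record.**  For cubic `f, g : 𝔽₂¹⁴ → 𝔽₂` with `g` bent (`W_g² ≡ 2¹⁴`):
`Φ(f,g) = 1` or `Φ(f,g) ≤ 57/64`.  Finite-slice statement; NOT summit progress. [this work] -/
theorem fo_bent_le_57_64 (f g : (Fin (7 + 7) → Bool) → Bool) (hf : IsDegLeFun 3 f) (hg : IsDegLeFun 3 g)
    (hbent : ∀ x, W (fun y => signOf (g y)) x ^ 2 = (2 : ℝ) ^ (7 + 7)) :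
    forrelation f g = 1 ∨ forrelation f g ≤ 57 / 64 := by
  classical
  obtain ⟨d, hd⟩ := bb_exists_dual hbent
  have hdeg : IsDegLeFun (4 + 1) d := stub_houCubic stub_axParity 7 g d hg hd
  have he : IsDegLeFun (4 + 1) (fun x => f x ^^ d x) := bb_isDegLeFun_bxor (hf.mono (by norm_num)) hdeg
  have hΦ := bb_forrelation_eq_of_dual f g d hd
  rw [← bb_filter_bxor_eq] at hΦ
  set N := #(univ.filter fun x : Fin (7 + 7) → Bool => (f x ^^ d x) = true) with hNdef
  have c14 : (2 : ℝ) ^ (7 + 7) = 16384 := by norm_num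
  rw [c14] at hΦ
  have h512 : N ≠ 512 := by
    intro h
    have : forrelation f g = 15 / 16 := by rw [hΦ, h]; norm_num
    exact fo_bent_false f g hf hg hbent this
  have h768 : N ≠ 768 := by
    intro h
    have : forrelation f g = 29 / 32 := by rw [hΦ, h]; norm_num
    exact fo_bent_ne_29_32 f g hf hg hbent this
  by_cases hlt : N < 896
  · -- then `N = 0`
    have hw := rm5_fourteen_weights_below_896 _ he hlt
    rw [← hNdef] at hw
    have h0 : N = 0 := by omega
    left; rw [hΦ, h0]; norm_num
  · right
    push Not at hlt
    rw [hΦ]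
    have : (896 : ℝ) ≤ N := by exact_mod_cast hlt
    have h1 : 2 * (896 : ℝ) / 16384 ≤ 2 * (N : ℝ) / 16384 := by
      apply div_le_div_of_nonneg_right _ (by norm_num); linarith
    calc 1 - 2 * (N : ℝ) / 16384 ≤ 1 - 2 * 896 / 16384 := by linarith
      _ = 57 / 64 := by norm_num

/-- **Inside the open window both sides are non-bent (`n = 14`).**  For cubic `f, g : 𝔽₂¹⁴ → 𝔽₂` with `57/64 < Φ(f,g) < 1`, `g` is NOT
bent; by the symmetry `Φ(f,g) = Φ(g,f)` (`forrelation_comm`) neither is `f`.  Finite-slice statement; NOT summit progress. [this work] -/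
theorem fo_window_sides_not_bent (f g : (Fin (7 + 7) → Bool) → Bool) (hf : IsDegLeFun 3 f) (hg : IsDegLeFun 3 g)
    (hlo : 57 / 64 < forrelation f g) (hhi : forrelation f g < 1) :
    (¬ ∀ x, W (fun y => signOf (g y)) x ^ 2 = (2 : ℝ) ^ (7 + 7)) ∧ ¬ ∀ x, W (fun y => signOf (f y)) x ^ 2 = (2 : ℝ) ^ (7 + 7) := by
  refine ⟨fun hb => ?_, fun hb => ?_⟩
  · rcases fo_bent_le_57_64 f g hf hg hb with h | h <;> linarith
  · have hsymm : forrelation f g = forrelation g f :=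
      Summit.QuantumAdvantage.QuantumAdvantage.Theorems.ExactPairsMaioranaMcFarland.Negative.forrelation_comm f g
    rw [hsymm] at hlo hhi
    rcases fo_bent_le_57_64 g f hg hf hb with h | h <;> linarith

end Summit.QuantumAdvantage.QuantumAdvantage.Theorems.CubicForrelation.NearExactIsExact

end
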